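import Literature.Analysis.FluidPDE.ClassicalSpeedBoundIncrements
import Literature.Analysis.UnboundedOperators.HeatExtensionDecay
import HarnessLib

/-!
# Bounded classical solutions: the overshoot of the speed above the initial maximum

Analysis/FluidPDE proof file (theorems only, everything proved). For a classical solution `u` of
the unforced Navier–Stokes equations on `ℝ³ × [0, T)` with viscosity `ν > 0`, bounded by `G` on
`[0, T'] × ℝ³` (`T' < T`), with slices uniformly in `L²`, and with `|u₀| ≤ B₀`:

  `‖u(t, x)‖ ≤ B₀ + C G² √(t/ν)`   for all `x` and `0 < t < T'`
  (`exists_norm_le_initial_add_of_speed_le`, `C` absolute).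

That is, the speed can exceed its initial maximum only by `O(G² √(t/ν))` at time `t`: the mild
formula from a time `s ∈ (0, t)` (`mild_of_bounded_of_eLpNorm_two_le_of_lt`, KNSS 2009 Lemma 3.1),
`u(t) = e^{ν(t-s)Δ}u(s) - B_s(u,u)(t)`, has a caloric part bounded by `sup|u(s)|` and a Duhamel part
bounded by `C G² √((t-s)/ν)` (`exists_norm_oseenDuhamel_le_mul`); letting `s → 0⁺`
(`tendsto_heatExtension_slice_nhdsGT`: `e^{ν(t-s)Δ}u(s)(x) → e^{νtΔ}u₀(x)` for jointly continuous
bounded `u`, dominated convergence) and using the maximum principle for the caloric extension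
(`norm_heatExtension_le_of_bound`) gives the claim. In the route `LevelSetModeration` this
quantifies for how long the super-level sets `{|u| > (1+θ)B₀}` stay empty
(`t < θ²B₀²ν/(C²G⁴)`), refining the early window `|u| ≤ 2B₀` for `t < c₀ν/B₀²`
(`exists_earlyWindow_norm_le`).

## References

* G. Koch, N. Nadirashvili, G. Seregin, V. Šverák, Acta Math. 203 (2009) = arXiv:0709.3599, §3
  Lemma 3.1, §4 p. 8 (the bound `‖B(u,u)(t)‖_∞ ≲ √t sup|u|²`). [KochNadirashviliSereginSverak2009]
* P. G. Lemarié-Rieusset, *The Navier–Stokes problem in the 21st century* (2016), Thm. 9.12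
  (proof, p. 260). [LemarieRieusset2016]
-/

noncomputable section

open MeasureTheory Set Function Filter Topology
open scoped ENNReal NNReal

namespace Literature.Analysis.FluidPDE

open UnboundedOperators (heatExtension heatKernel heatExtension_apply heatKernel_pos heatKernel_eq
  integrable_heatKernel_holds continuous_heatKernel norm_heatExtension_le_of_bound)

/-! ### Continuity of the caloric part of the mild formula at the initial time -/

/-- **The caloric part of the mild formula is continuous at the initial time.** If `u` is jointly
continuous on `[a, b) × E` and bounded by `L` there, then for `a < t < b` and every `x`,
`e^{(t-s)Δ}u(s)(x) → e^{(t-a)Δ}u(a)(x)` as `s → a⁺` (dominated convergence: for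
`s ≤ (a+t)/2` the kernels `G_{t-s}` are dominated by `2^{n/2} G_{t-a}`-type Gaussians). [folklore] -/
theorem tendsto_heatExtension_slice_nhdsGT {E F : Type*} [NormedAddCommGroup E]
    [InnerProductSpace ℝ E] [FiniteDimensional ℝ E] [MeasurableSpace E] [BorelSpace E]
    [NormedAddCommGroup F] [NormedSpace ℝ F] [CompleteSpace F]
    {a b t : ℝ} {u : ℝ → E → F} (hu : ContinuousOn (uncurry u) (Ico a b ×ˢ univ))
    {L : ℝ} (hbd : ∀ s ∈ Ico a b, ∀ y, ‖u s y‖ ≤ L) (hat : a < t) (htb : t < b) (x : E) :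
    Tendsto (fun s => heatExtension (u s) (t - s) x) (𝓝[>] a)
      (𝓝 (heatExtension (u a) (t - a) x)) := by
  have hta : 0 < t - a := sub_pos.2 hat
  have hL0 : 0 ≤ L := (norm_nonneg _).trans (hbd a ⟨le_rfl, hat.trans htb⟩ x)
  set n : ℝ := (Module.finrank ℝ E : ℝ) with hn
  -- the dominating Gaussian
  set M : ℝ := (4 * Real.pi * ((t - a) / 2)) ^ (-n / 2) with hM
  have hMpos : 0 < M := by rw [hM]; exact Real.rpow_pos_of_pos (by positivity) _
  set bound : E → ℝ := fun y => M * Real.exp (-(1 / (4 * (t - a))) * ‖y‖ ^ 2) * L with hbound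
  simp only [heatExtension_apply]
  refine tendsto_integral_filter_of_dominated_convergence bound ?_ ?_ ?_ ?_
  · -- measurability of the integrands
    filter_upwards [Ioo_mem_nhdsGT hat] with s hs
    have hsI : s ∈ Ico a b := ⟨hs.1.le, hs.2.trans htb⟩
    have hcont : Continuous (u s) :=
      (hu.comp_continuous (Continuous.prodMk_right s) fun y => ⟨hsI, mem_univ _⟩ :)
    exact ((continuous_heatKernel _).smul
      (hcont.comp (continuous_const.sub continuous_id))).aestronglyMeasurable
  · -- domination for `s ∈ (a, (a+t)/2)`
    have hmid : a < (a + t) / 2 := by linarith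
    filter_upwards [Ioo_mem_nhdsGT hmid] with s hs
    have hsI : s ∈ Ico a b := ⟨hs.1.le, by linarith [hs.2]⟩
    refine Eventually.of_forall fun y => ?_
    have hr : (t - a) / 2 ≤ t - s := by linarith [hs.2]
    have hr' : t - s ≤ t - a := by linarith [hs.1]
    have hrpos : 0 < t - s := by linarith
    rw [norm_smul, Real.norm_of_nonneg (heatKernel_pos hrpos y).le, hbound]
    refine mul_le_mul ?_ (hbd s hsI _) (norm_nonneg _) (by positivity)
    rw [heatKernel_eq]
    refine mul_le_mul ?_ ?_ (by positivity) hMpos.le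
    · rw [hM]
      exact Real.rpow_le_rpow_of_nonpos (by positivity) (by nlinarith [Real.pi_pos])
        (div_nonpos_of_nonpos_of_nonneg (neg_nonpos.2 (Nat.cast_nonneg _)) two_pos.le)
    · refine Real.exp_le_exp.2 ?_
      have h1 : 1 / (4 * (t - a)) ≤ 1 / (4 * (t - s)) :=
        one_div_le_one_div_of_le (by positivity) (by linarith)
      nlinarith [sq_nonneg ‖y‖]
  · -- integrability of the bound (a multiple of the heat kernel at time `t - a`)
    have hK := integrable_heatKernel_holds (E := E) hta
    have heq : bound = fun y => (M * L / (4 * Real.pi * (t - a)) ^ (-n / 2)) * heatKernel (t - a) y := by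
      funext y
      rw [hbound, heatKernel_eq, ← hn]
      have hc : (4 * Real.pi * (t - a)) ^ (-n / 2) ≠ 0 :=
        (Real.rpow_pos_of_pos (by positivity) _).ne'
      field_simp
    rw [heq]
    exact hK.const_mul _
  · -- pointwise convergence
    refine Eventually.of_forall fun y => ?_
    have h1 : Tendsto (fun s => heatKernel (t - s) y) (𝓝[>] a) (𝓝 (heatKernel (t - a) y)) := by
      have hcont : ContinuousAt (fun r : ℝ => heatKernel r y) (t - a) := by
        simp only [heatKernel_eq]
        refine ContinuousAt.mul ?_ ?_
        · exact ContinuousAt.rpow_const (by fun_prop) (Or.inl (by positivity))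
        · refine Real.continuous_exp.continuousAt.comp ?_
          refine ContinuousAt.mul (ContinuousAt.neg ?_) continuousAt_const
          exact ContinuousAt.div continuousAt_const (by fun_prop) (by positivity)
      have h2 : Tendsto (fun s : ℝ => t - s) (𝓝[>] a) (𝓝 (t - a)) :=
        ((continuous_const.sub continuous_id).tendsto a).mono_left nhdsWithin_le_nhds
      exact hcont.tendsto.comp h2
    have h2 : Tendsto (fun s => u s (x - y)) (𝓝[>] a) (𝓝 (u a (x - y))) := by
      have hz : (a, x - y) ∈ Ico a b ×ˢ (univ : Set E) := ⟨⟨le_rfl, hat.trans htb⟩, mem_univ _⟩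
      have hc := hu (a, x - y) hz
      have h3 : Tendsto (fun s : ℝ => (s, x - y)) (𝓝[>] a) (𝓝[Ico a b ×ˢ univ] (a, x - y)) := by
        refine tendsto_nhdsWithin_iff.2 ⟨?_, ?_⟩
        · exact ((continuous_id.prodMk continuous_const).tendsto a).mono_left nhdsWithin_le_nhds
        · filter_upwards [Ioo_mem_nhdsGT (hat.trans htb)] with s hs
          exact ⟨⟨hs.1.le, hs.2⟩, mem_univ _⟩
      exact hc.tendsto.comp h3
    exact h1.smul h2

/-! ### Unit viscosity, unit bound -/

/-- **Overshoot bound for unit-bounded classical solutions** (`ν = 1`): with `C₀` the constant of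
`exists_norm_oseenDuhamel_le_mul`, every classical solution on `ℝ³ × [a, b)` with `‖u‖ ≤ 1` on
`[a, T] × ℝ³`, `T < b`, `‖u(t)‖_{L²} ≤ K < ∞` on `(a, T]`, and `‖u(a, ·)‖ ≤ B` satisfies
`‖u(t, x)‖ ≤ B + 2C₀ √(t - a)` for `a < t < T` (mild formula from `s ↓ a`, maximum principle for the
caloric part, `‖B_s(u,u)(t)‖ ≤ 2C₀√(t-s)`).
[cite: KochNadirashviliSereginSverak2009, §3 Lemma 3.1 and §4 p. 8 (arXiv:0709.3599)] -/
theorem exists_norm_le_initial_add_of_classical_unit :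
    ∃ C₃ : ℝ, 0 < C₃ ∧ ∀ {a b T B : ℝ} {u : ℝ → EuclideanSpace ℝ (Fin 3) → EuclideanSpace ℝ (Fin 3)}
      {p : ℝ → EuclideanSpace ℝ (Fin 3) → ℝ}, IsClassicalNSSolutionOn (Ico a b) 1 0 u p →
      a < T → T < b → (∀ t ∈ Icc a T, ∀ x, ‖u t x‖ ≤ 1) → ∀ {K : ℝ≥0∞}, K ≠ ∞ →
      (∀ t ∈ Ioc a T, eLpNorm (u t) 2 volume ≤ K) → (∀ x, ‖u a x‖ ≤ B) →
      ∀ t ∈ Ioo a T, ∀ x, ‖u t x‖ ≤ B + C₃ * Real.sqrt (t - a) := by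
  obtain ⟨C₀, hC₀, hB⟩ := exists_norm_oseenDuhamel_le_mul (E := EuclideanSpace ℝ (Fin 3))
  refine ⟨2 * C₀, by positivity, ?_⟩
  intro a b T B u p hcl haT hTb hbd K hK hL2 hB0 t ht x
  have hcl' : IsClassicalNSSolutionOn (Ioo a b) 1 0 u p :=
    hcl.mono Ioo_subset_Ico_self (uniqueDiffOn_Ioo a b)
  have hbd' : ∀ s ∈ Ioc a T, ∀ y, ‖u s y‖ ≤ 1 := fun s hs y => hbd s ⟨hs.1.le, hs.2⟩ y
  have hta : 0 < t - a := sub_pos.2 ht.1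
  -- the two-time inequality from the mild formula, for every `s ∈ (a, t)`
  have htwo : ∀ s ∈ Ioo a t, ‖u t x‖ ≤ ‖heatExtension (u s) (t - s) x‖ + 2 * C₀ * Real.sqrt (t - a) := by
    intro s hs
    have hmild := mild_of_bounded_of_eLpNorm_two_le_of_lt hcl' haT hTb hbd' hK hL2 hs.1 hs.2 ht.2 x
    have hbdI : ∀ τ ∈ Ioo s t, ∀ y, ‖u τ y‖ ≤ 1 :=
      fun τ hτ y => hbd τ ⟨(hs.1.trans hτ.1).le, (hτ.2.trans ht.2).le⟩ y
    have hduh : ‖oseenDuhamel 1 s u u t x‖ ≤ 2 * C₀ * Real.sqrt (t - s) := by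
      have h := hB one_pos hs.2 zero_le_one zero_le_one hbdI hbdI x
      rw [Real.one_rpow] at h
      linarith
    have hsqrt : Real.sqrt (t - s) ≤ Real.sqrt (t - a) := Real.sqrt_le_sqrt (by linarith [hs.1])
    calc ‖u t x‖ = ‖heatExtension (u s) (t - s) x - oseenDuhamel 1 s u u t x‖ := by rw [← hmild]
      _ ≤ ‖heatExtension (u s) (t - s) x‖ + ‖oseenDuhamel 1 s u u t x‖ := norm_sub_le _ _
      _ ≤ ‖heatExtension (u s) (t - s) x‖ + 2 * C₀ * Real.sqrt (t - a) := by
          have : 2 * C₀ * Real.sqrt (t - s) ≤ 2 * C₀ * Real.sqrt (t - a) :=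
            mul_le_mul_of_nonneg_left hsqrt (by positivity)
          linarith
  -- let `s → a⁺`: the caloric part tends to `e^{(t-a)Δ}u(a)(x)`, bounded by `B`
  have hcont : ContinuousOn (uncurry u) (Ico a T ×ˢ univ) :=
    hcl.smooth_velocity.continuousOn.mono (prod_mono (Ico_subset_Ico_right hTb.le) Subset.rfl)
  have hbdT : ∀ s ∈ Ico a T, ∀ y, ‖u s y‖ ≤ 1 := fun s hs y => hbd s ⟨hs.1, hs.2.le⟩ y
  have hlim := (tendsto_heatExtension_slice_nhdsGT hcont hbdT ht.1 ht.2 x).norm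
  have hev : ∀ᶠ s in 𝓝[>] a, ‖u t x‖ ≤ ‖heatExtension (u s) (t - s) x‖ + 2 * C₀ * Real.sqrt (t - a) := by
    filter_upwards [Ioo_mem_nhdsGT ht.1] with s hs
    exact htwo s hs
  have hle : ‖u t x‖ ≤ ‖heatExtension (u a) (t - a) x‖ + 2 * C₀ * Real.sqrt (t - a) :=
    ge_of_tendsto (hlim.add_const _) hev
  have hmax : ‖heatExtension (u a) (t - a) x‖ ≤ B := norm_heatExtension_le_of_bound hB0 hta x
  linarith

/-! ### General viscosity and bound -/

/-- **Overshoot bound under a speed bound (scale-invariant form).** There is an absolute `C > 0`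
such that: for `ν > 0`, `G > 0`, every classical solution with viscosity `ν` on `ℝ³ × [0, T)`
bounded by `G` on `[0, T'] × ℝ³` (`T' < T`), with slices uniformly in `L²` there, and with
`‖u(0, ·)‖ ≤ B₀`, satisfies `‖u(t, x)‖ ≤ B₀ + C G² √(t/ν)` for all `x` and `0 < t < T'`
(scaling `u ↦ G⁻¹u(νt/G², νx/G)` of `exists_norm_le_initial_add_of_classical_unit`). In particular
the super-level set `{‖u(t)‖ > (1+θ)B₀}` is empty for `t < θ²B₀²ν/(C²G⁴)`.
[cite: KochNadirashviliSereginSverak2009, §3 Lemma 3.1 and §4 p. 8 (arXiv:0709.3599)] -/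
theorem exists_norm_le_initial_add_of_speed_le :
    ∃ C : ℝ, 0 < C ∧ ∀ {ν T T' G B₀ : ℝ} {u : ℝ → EuclideanSpace ℝ (Fin 3) → EuclideanSpace ℝ (Fin 3)}
      {p : ℝ → EuclideanSpace ℝ (Fin 3) → ℝ}, 0 < ν → 0 < G →
      IsClassicalNSSolutionOn (Ico 0 T) ν 0 u p → 0 < T' → T' < T →
      (∀ t ∈ Icc 0 T', ∀ x, ‖u t x‖ ≤ G) → ∀ {K : ℝ≥0∞}, K ≠ ∞ →
      (∀ t ∈ Icc 0 T', eLpNorm (u t) 2 volume ≤ K) → (∀ x, ‖u 0 x‖ ≤ B₀) →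
      ∀ t ∈ Ioo 0 T', ∀ x, ‖u t x‖ ≤ B₀ + C * G ^ 2 * Real.sqrt (t / ν) := by
  obtain ⟨C₃, hC₃, hunit⟩ := exists_norm_le_initial_add_of_classical_unit
  refine ⟨C₃, hC₃, ?_⟩
  intro ν T T' G B₀ u p hν hG hcl hT' hT'T hbd K hK hL2 hB0 t ht x
  set α : ℝ := G⁻¹ with hα
  set γ : ℝ := ν / G with hγ
  set β : ℝ := ν / G ^ 2 with hβ
  have hαpos : 0 < α := by rw [hα]; positivity
  have hγpos : 0 < γ := by rw [hγ]; positivity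
  have hβpos : 0 < β := by rw [hβ]; positivity
  have hβαγ : β = α * γ := by rw [hβ, hα, hγ]; field_simp
  have hcl' := hcl.stRescale hαpos hγpos hβαγ 0 0
  have hS : ((fun r => (0 : ℝ) + β * r) ⁻¹' Ico 0 T) = Ico 0 (T / β) := by
    ext r
    simp only [mem_preimage, mem_Ico, zero_add]
    constructor
    · rintro ⟨h1, h2⟩
      exact ⟨nonneg_of_mul_nonneg_right h1 hβpos, (lt_div_iff₀' hβpos).2 h2⟩
    · rintro ⟨h1, h2⟩
      exact ⟨mul_nonneg hβpos.le h1, (lt_div_iff₀' hβpos).1 h2⟩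
  have hν1 : α * ν / γ = 1 := by rw [hα, hγ]; field_simp
  rw [hS, hν1, smul_stPull_zero] at hcl'
  set w : ℝ → EuclideanSpace ℝ (Fin 3) → EuclideanSpace ℝ (Fin 3) := α • stPull β γ 0 0 u with hw
  have hwapp : ∀ s y, w s y = α • u (β * s) (γ • y) := by
    intro s y
    simp only [hw, Pi.smul_apply, stPull_apply, zero_add]
  have hT'β : 0 < T' / β := div_pos hT' hβpos
  have hT'βT : T' / β < T / β := div_lt_div_of_pos_right hT'T hβpos
  have hmemI : ∀ {s : ℝ}, s ∈ Icc 0 (T' / β) → β * s ∈ Icc 0 T' := by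
    intro s hs
    refine ⟨mul_nonneg hβpos.le hs.1, ?_⟩
    have := hs.2
    rwa [le_div_iff₀' hβpos] at this
  have hbd' : ∀ s ∈ Icc 0 (T' / β), ∀ y, ‖w s y‖ ≤ 1 := by
    intro s hs y
    rw [hwapp, norm_smul, Real.norm_of_nonneg hαpos.le, hα]
    have := hbd (β * s) (hmemI hs) (γ • y)
    calc G⁻¹ * ‖u (β * s) (γ • y)‖ ≤ G⁻¹ * G := by gcongr
      _ = 1 := inv_mul_cancel₀ hG.ne'
  set K' : ℝ≥0∞ := ENNReal.ofReal |α| * (ENNReal.ofReal (γ ^ 3)⁻¹) ^ (1 / 2 : ℝ) * K with hK'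
  have hK'top : K' ≠ ∞ := by
    refine ENNReal.mul_ne_top (ENNReal.mul_ne_top ENNReal.ofReal_ne_top ?_) hK
    exact ENNReal.rpow_ne_top_of_nonneg (by norm_num) ENNReal.ofReal_ne_top
  have hL2' : ∀ s ∈ Ioc 0 (T' / β), eLpNorm (w s) 2 volume ≤ K' := by
    intro s hs
    have h1 : w s = fun y => α • u (β * s) ((0 : EuclideanSpace ℝ (Fin 3)) + γ • y) := by
      funext y; rw [hwapp, zero_add]
    rw [h1]
    refine (eLpNorm_two_smul_comp_affine_le α hγpos 0).trans ?_
    rw [hK']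
    gcongr
    exact hL2 (β * s) (hmemI ⟨hs.1.le, hs.2⟩)
  have hB0' : ∀ y, ‖w 0 y‖ ≤ α * B₀ := by
    intro y
    rw [hwapp, mul_zero, norm_smul, Real.norm_of_nonneg hαpos.le]
    exact mul_le_mul_of_nonneg_left (hB0 _) hαpos.le
  have htβ : t / β ∈ Ioo 0 (T' / β) := ⟨div_pos ht.1 hβpos, div_lt_div_of_pos_right ht.2 hβpos⟩
  have key := hunit hcl' hT'β hT'βT hbd' hK'top hL2' hB0' (t / β) htβ (γ⁻¹ • x)
  -- undo the scaling
  have hwt : w (t / β) (γ⁻¹ • x) = α • u t x := by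
    rw [hwapp, mul_div_cancel₀ _ hβpos.ne', smul_smul, mul_inv_cancel₀ hγpos.ne', one_smul]
  rw [hwt, norm_smul, Real.norm_of_nonneg hαpos.le, sub_zero] at key
  have hsq : Real.sqrt (t / β) = G * Real.sqrt (t / ν) := by
    rw [hβ, show t / (ν / G ^ 2) = G ^ 2 * (t / ν) by field_simp, Real.sqrt_mul (sq_nonneg G),
      Real.sqrt_sq hG.le]
  rw [hsq, hα] at key
  -- `G⁻¹ ‖u t x‖ ≤ G⁻¹ B₀ + C₃ G √(t/ν)`
  have hmul := mul_le_mul_of_nonneg_left key hG.le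
  rw [← mul_assoc, mul_inv_cancel₀ hG.ne', one_mul, mul_add, ← mul_assoc, mul_inv_cancel₀ hG.ne',
    one_mul] at hmul
  calc ‖u t x‖ ≤ B₀ + G * (C₃ * (G * Real.sqrt (t / ν))) := hmul
    _ = B₀ + C₃ * G ^ 2 * Real.sqrt (t / ν) := by ring

end Literature.Analysis.FluidPDE

end
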